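import Summits.Ventures.DiscreteObjects.Hadamard.Hadamard4qOrder2qNega
import Summits.Ventures.DiscreteObjects.Hadamard.Order668Excluded

/-!
# Hadamard matrices of order 4q (q ≥ 5 prime) have no automorphism of order 4q (kernel)

Framing: lottery ticket; floor = certified bounds/negative ranges.

Cell pub-namedobj (venture DiscreteObjects), target (H), hadamard gen 12.  Uniform exclusion: **`no_hadamard4q_signedAut_order4q`** —
a Hadamard matrix of order `4q`, `q ≥ 5` prime, has no signed-permutation automorphism whose permutation pair has order `4q`
(`hadamard4q_signedAut_orderOf_ne_4q`); for ALL such `q`, not only `q ≡ 3 (mod 4)`.  Proof: by `hadamard4q_order2q_fpf` applied to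
the square, `π^(2q)` and `κ^(2q)` are fixed-point-free, so `π`, `κ` are single `4q`-cycles (a fixed point of `π^k` would give one of
`π⁴` — excluded by `hadamard4q_fixedRows` — or of `π^(2q)`); the cycle sign products `D`, `E` satisfy `D_i E_j = 1`, so they all
equal one sign `δ`.  If `δ = −1` the matrix is equivalent to a negacyclic one, impossible in order `4q ≡ 4 (mod 8)`
(`no_signedAut_regular_nega`, via `NegacyclicObstruction`); if `δ = +1` it is equivalent to a circulant one, and the re-signed orbit
array gives `a² = 4q` (`two_circulant_sq_identity` with both blocks equal), impossible for `q` prime.  In particular a Hadamard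
matrix of order `668`, `716` or `892` has no automorphism of order `668`, `716`, `892` respectively.  (The classical statement
'no circulant Hadamard matrix of non-square order' is the `δ = +1` half; the negacyclic half is ours.)  Ours, not literature; no `sorry`.
-/

namespace Summit.Ventures.DiscreteObjects.Hadamard

open Finset BigOperators Matrix

open Literature.Combinatorics.Designs.GoethalsSeidel (IsHadamardMatrix)

variable {ι : Type*} [Fintype ι] [DecidableEq ι]

variable {H : Matrix ι ι ℤ} {π κ : Equiv.Perm ι} {d e : ι → ℤ} {q : ℕ}

/-- `4q` is not a square for `q ≥ 5` prime -/
lemma not_sq_four_mul_prime (hq : q.Prime) (hq5 : 5 ≤ q) (a : ℤ) : a ^ 2 ≠ 4 * q := by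
  intro h
  have hn : a.natAbs ^ 2 = 4 * q := by
    have : ((a.natAbs ^ 2 : ℕ) : ℤ) = ((4 * q : ℕ) : ℤ) := by push_cast; rw [sq_abs, h]
    exact_mod_cast this
  have hqa : q ∣ a.natAbs := by
    have : q ∣ a.natAbs ^ 2 := ⟨4, by rw [hn]; ring⟩
    exact hq.dvd_of_dvd_pow this
  obtain ⟨c, hc⟩ := hqa
  have h2 : q * (q * c ^ 2) = q * 4 := by
    have : (q * c) ^ 2 = 4 * q := by rw [← hc, hn]
    nlinarith [this]
  have h3 : q * c ^ 2 = 4 := Nat.eq_of_mul_eq_mul_left hq.pos h2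
  rcases Nat.eq_zero_or_pos c with h0 | h0
  · subst h0; simp at h3
  · have : q ∣ 4 := ⟨c ^ 2, h3.symm⟩
    have hle := Nat.le_of_dvd (by norm_num) this
    omega

/-- **Order 4q, all primes `q ≥ 5`: single cycles.**  `π^(4q) = κ^(4q) = 1`, `(π⁴, κ⁴) ≠ (1,1)`, `(π^(2q), κ^(2q)) ≠ (1,1)` force `π`,
`κ` to be single `4q`-cycles. -/
theorem hadamard4q_order4q_cycle' (hH : IsHadamardMatrix H) (hq : q.Prime) (hq5 : 5 ≤ q) (hι : Fintype.card ι = 4 * q)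
    (haut : IsSignedAut H π κ d e)
    (hπ : π ^ (4 * q) = 1) (hκ : κ ^ (4 * q) = 1) (h4 : π ^ 4 ≠ 1 ∨ κ ^ 4 ≠ 1) (h2q : π ^ (2 * q) ≠ 1 ∨ κ ^ (2 * q) ≠ 1) :
    (∀ i k, 0 < k → k < 4 * q → (π ^ k) i ≠ i) ∧ (∀ j k, 0 < k → k < 4 * q → (κ ^ k) j ≠ j) := by
  have haut2 : IsSignedAut H (π ^ 2) (κ ^ 2) (fun i => cyc π d i 2) (fun j => cyc κ e j 2) := isSignedAut_pow haut 2
  have e42 : 4 * q = 2 * (2 * q) := by ring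
  have hπ2 : (π ^ 2) ^ (2 * q) = 1 := by rw [← pow_mul, ← e42]; exact hπ
  have hκ2 : (κ ^ 2) ^ (2 * q) = 1 := by rw [← pow_mul, ← e42]; exact hκ
  have h2' : (π ^ 2) ^ 2 ≠ 1 ∨ (κ ^ 2) ^ 2 ≠ 1 := by rw [← pow_mul, ← pow_mul]; exact h4
  have hq' : (π ^ 2) ^ q ≠ 1 ∨ (κ ^ 2) ^ q ≠ 1 := by rw [← pow_mul, ← pow_mul]; exact h2q
  obtain ⟨hr, hc⟩ := hadamard4q_order2q_fpf hH q hq hq5 hι _ _ _ _ haut2 hπ2 hκ2 h2' hq'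
  rw [← pow_mul] at hr hc
  have hfix := hadamard4q_fixedRows hH q hq hq5 hι (π ^ 4) (κ ^ 4) _ _ (isSignedAut_pow haut 4)
    (by rw [← pow_mul]; exact hπ) (by rw [← pow_mul]; exact hκ) h4
  have fpf4 : ∀ (σ : Equiv.Perm ι), (univ.filter fun i => (σ ^ 4) i = i).card = 0 → ∀ i, (σ ^ 4) i ≠ i := by
    intro σ h0 i hi
    have hmem : i ∈ univ.filter (fun i => (σ ^ 4) i = i) := by simp [hi]
    rw [Finset.card_eq_zero.mp h0] at hmem
    simp at hmem
  have key : ∀ (σ : Equiv.Perm ι), σ ^ (4 * q) = 1 → (∀ i, (σ ^ (2 * q)) i ≠ i) → (∀ i, (σ ^ 4) i ≠ i) →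
      ∀ i k, 0 < k → k < 4 * q → (σ ^ k) i ≠ i := by
    intro σ hσ h2q' h4' i k hk0 hk hk_fix
    by_cases hdvd : q ∣ k
    · obtain ⟨t, rfl⟩ := hdvd
      have ht : t < 4 := Nat.lt_of_mul_lt_mul_left (by rw [mul_comm 4 q] at hk; exact hk)
      have h2q_of_q : (σ ^ q) i = i → False := fun h1 =>
        h2q' i (by rw [mul_comm 2 q, pow_mul]; exact perm_pow_apply_of_fixed _ h1 2)
      interval_cases t
      · simp at hk0
      · exact h2q_of_q (by simpa using hk_fix)
      · exact h2q' i (by rw [mul_comm 2 q]; exact hk_fix)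
      · have h3 : (σ ^ (q * 3 * 3)) i = i := by rw [pow_mul]; exact perm_pow_apply_of_fixed _ hk_fix 3
        have e1 : σ ^ (q * 3 * 3) = σ ^ q := by
          rw [show q * 3 * 3 = (4 * q) * 2 + q by ring, pow_add, pow_mul, hσ, one_pow, one_mul]
        rw [e1] at h3
        exact h2q_of_q h3
    · have hcop : Nat.Coprime k q := (Nat.Prime.coprime_iff_not_dvd hq).mpr hdvd |>.symm
      have h1 : ((σ ^ 4) ^ k) i = i := by
        rw [← pow_mul, mul_comm, pow_mul]
        exact perm_pow_apply_of_fixed _ hk_fix 4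
      have h2 : ((σ ^ 4) ^ q) i = i := by
        rw [← pow_mul, hσ, Equiv.Perm.one_apply]
      exact h4' i (perm_fixed_of_pow_coprime (σ ^ 4) hcop hq.one_lt h1 h2)
  exact ⟨key π hπ hr (fpf4 π hfix.1), key κ hκ hc (fpf4 κ hfix.2.1)⟩

/-- **No automorphism of order 4q** (order `4q`, `q ≥ 5` prime): `π^(4q) = κ^(4q) = 1` with `(π⁴, κ⁴) ≠ (1,1)` and
`(π^(2q), κ^(2q)) ≠ (1,1)` is impossible. -/
theorem no_hadamard4q_signedAut_order4q (hH : IsHadamardMatrix H) (hq : q.Prime) (hq5 : 5 ≤ q) (hι : Fintype.card ι = 4 * q)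
    (haut : IsSignedAut H π κ d e)
    (hπ : π ^ (4 * q) = 1) (hκ : κ ^ (4 * q) = 1) (h4 : π ^ 4 ≠ 1 ∨ κ ^ 4 ≠ 1) (h2q : π ^ (2 * q) ≠ 1 ∨ κ ^ (2 * q) ≠ 1) :
    False := by
  have hd := haut.1
  have he := haut.2.1
  have hA := haut.2.2
  have hqodd : q % 2 = 1 := Nat.odd_iff.mp (hq.odd_of_ne_two (by omega))
  have hn8 : Fintype.card ι % 8 = 4 := by rw [hι]; omega
  obtain ⟨hfr, hfc⟩ := hadamard4q_order4q_cycle' hH hq hq5 hι haut hπ hκ h4 h2q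
  -- D i * E j = 1
  have hDE : ∀ i j, cyc π d i (4 * q) * cyc κ e j (4 * q) = 1 := by
    intro i j
    have h := signedAut_pow haut (4 * q) i j
    rw [hπ, hκ, Equiv.Perm.one_apply, Equiv.Perm.one_apply] at h
    have hne := pm_ne_zero (hH.1 i j)
    have : (cyc π d i (4 * q) * cyc κ e j (4 * q) - 1) * H i j = 0 := by linarith
    rcases mul_eq_zero.mp this with h0 | h0
    · linarith
    · exact (hne h0).elim
  obtain ⟨i₀⟩ : Nonempty ι := by rw [← Fintype.card_pos_iff, hι]; omega
  rcases cyc_pm κ e he i₀ (4 * q) with hE1 | hEneg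
  · -- δ = +1: all products are +1; circulant type ⇒ a² = 4q
    have hE : ∀ j, cyc κ e j (4 * q) = 1 := by
      intro j
      have h1 := hDE i₀ i₀
      have h2 := hDE i₀ j
      rw [hE1, mul_one] at h1
      rw [h1, one_mul] at h2
      exact h2
    have hD : ∀ i, cyc π d i (4 * q) = 1 := by
      intro i; have := hDE i i₀; rw [hE i₀, mul_one] at this; exact this
    set j₀ := i₀ with hj₀def
    have hO : orbFin κ (4 * q) j₀ = univ :=
      Finset.eq_univ_of_card _ (by rw [card_orbFin_of_free (hfc j₀), hι])
    set x : ℕ → ℕ → ℤ := fun k m => cyc π d i₀ k * cyc κ e j₀ m * H ((π ^ k) i₀) ((κ ^ m) j₀) with hxdef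
    have hx : ∀ k m, x k m = 1 ∨ x k m = -1 := by
      intro k m
      rcases cyc_pm π d hd i₀ k with h1 | h1 <;> rcases cyc_pm κ e he j₀ m with h2 | h2 <;>
        rcases hH.1 ((π ^ k) i₀) ((κ ^ m) j₀) with h3 | h3 <;> simp [hxdef, h1, h2, h3]
    have hshift : ∀ k m, x (k + 1) (m + 1) = x k m := by
      intro k m
      simp only [hxdef]
      rw [cyc_succ', cyc_succ', pow_succ', pow_succ', Equiv.Perm.mul_apply, Equiv.Perm.mul_apply, hA]
      have h1 := pm_mul_self (hd ((π ^ k) i₀))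
      have h2 := pm_mul_self (he ((κ ^ m) j₀))
      calc cyc π d i₀ k * d ((π ^ k) i₀) * (cyc κ e j₀ m * e ((κ ^ m) j₀)) *
            (d ((π ^ k) i₀) * e ((κ ^ m) j₀) * H ((π ^ k) i₀) ((κ ^ m) j₀))
          = (d ((π ^ k) i₀) * d ((π ^ k) i₀)) * (e ((κ ^ m) j₀) * e ((κ ^ m) j₀)) *
            (cyc π d i₀ k * cyc κ e j₀ m * H ((π ^ k) i₀) ((κ ^ m) j₀)) := by ring
        _ = cyc π d i₀ k * cyc κ e j₀ m * H ((π ^ k) i₀) ((κ ^ m) j₀) := by rw [h1, h2, one_mul, one_mul]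
    have hperk : ∀ k m, x (k + 4 * q) m = x k m := by
      intro k m; simp only [hxdef]; rw [cyc_add, hD, mul_one, pow_add, hπ, mul_one]
    have hperm : ∀ k m, x k (m + 4 * q) = x k m := by
      intro k m; simp only [hxdef]; rw [cyc_add, hE, mul_one, pow_add, hκ, mul_one]
    have horth : ∀ k, 0 < k → k < 4 * q → ∑ m ∈ range (4 * q), (x 0 m * x k m + x 0 m * x k m) = 0 := by
      intro k hk0 hk
      have hrow := hadamard_row_orth H hH (Ne.symm (hfr i₀ k hk0 hk))
      rw [← hO, sum_orbFin_of_free (hfc j₀)] at hrow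
      have e1 : ∀ m, x 0 m * x k m = cyc π d i₀ k * (H i₀ ((κ ^ m) j₀) * H ((π ^ k) i₀) ((κ ^ m) j₀)) := by
        intro m
        simp only [hxdef]
        have h0 : cyc π d i₀ 0 = 1 := by simp [cyc]
        have h2 := pm_mul_self (cyc_pm κ e he j₀ m)
        rw [h0, pow_zero, Equiv.Perm.one_apply]
        calc 1 * cyc κ e j₀ m * H i₀ ((κ ^ m) j₀) * (cyc π d i₀ k * cyc κ e j₀ m * H ((π ^ k) i₀) ((κ ^ m) j₀))
            = (cyc κ e j₀ m * cyc κ e j₀ m) * (cyc π d i₀ k * (H i₀ ((κ ^ m) j₀) * H ((π ^ k) i₀) ((κ ^ m) j₀))) := by ring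
          _ = _ := by rw [h2, one_mul]
      rw [Finset.sum_congr rfl fun m _ => by rw [← two_mul, e1 m], ← Finset.mul_sum, ← Finset.mul_sum, hrow,
        mul_zero, mul_zero]
    have hsq := two_circulant_sq_identity (4 * q) x x hx hx hshift hshift hperk hperm hperk hperm horth
    have h2 : (∑ m ∈ range (4 * q), x 0 m) ^ 2 = 4 * q := by
      push_cast at hsq
      linarith
    exact not_sq_four_mul_prime hq hq5 _ h2
  · -- δ = −1: negacyclic type, impossible in order 4q ≡ 4 (mod 8)
    have hE : ∀ j, cyc κ e j (4 * q) = -1 := by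
      intro j
      have h1 := hDE i₀ i₀
      have h2 := hDE i₀ j
      rw [hEneg] at h1
      have hDi : cyc π d i₀ (4 * q) = -1 := by linarith [cyc_pm π d hd i₀ (4 * q)]
      rw [hDi] at h2
      linarith [cyc_pm κ e he j (4 * q)]
    exact no_signedAut_regular_nega hH hn8 haut (by rw [hι]; exact hκ) (by rw [hι]; exact hfr) (by rw [hι]; exact hfc)
      (by rw [hι]; exact hE)

/-- **Order form.**  The permutation pair of a signed automorphism of a Hadamard matrix of order `4q` (`q ≥ 5` prime) never has
order `4q`; in particular no Hadamard matrix of order `668`, `716`, `892` has an automorphism of order `668`, `716`, `892`. -/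
theorem hadamard4q_signedAut_orderOf_ne_4q (hH : IsHadamardMatrix H) (q : ℕ) (hq : q.Prime) (hq5 : 5 ≤ q)
    (hι : Fintype.card ι = 4 * q) (π κ : Equiv.Perm ι) (d e : ι → ℤ) (haut : IsSignedAut H π κ d e) :
    orderOf ((π, κ) : Equiv.Perm ι × Equiv.Perm ι) ≠ 4 * q := by
  intro hord
  obtain ⟨hπ, hκ, h4⟩ := pow_data_of_orderOf hord (a := 4) (by norm_num) (by omega)
  obtain ⟨-, -, h2q⟩ := pow_data_of_orderOf hord (a := 2 * q) (by omega) (by omega)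
  exact no_hadamard4q_signedAut_order4q hH hq hq5 hι haut hπ hκ h4 h2q

end Summit.Ventures.DiscreteObjects.Hadamard
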